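import Literature.AlgebraicGeometry.Hu2025.Proofs.S04ModelV.Lem45
import HarnessLib

/-!
# Hu 2025 §4.1, Lem. 4.4 ‹chunk Lem. 4.3› «`𝕌_[k] ⊂ ℛ_[k]` is defined by the ideal `ker^{mh} φ_[k]` — This is immediate»:
# DISCHARGED AS TYPED (`Lem4_4_holds`), via the block multidegree and the graph parametrisation on monomials
# (file `Proofs/S04ModelV/Lem44.lean`, typer of record res-type-042, row 103)

**HONEST FRAMING (D-0012/D-0089).** A theorem about OUR rendering `S04ModelV.Lem4_4` / `modelUIdeal` / `kerMH` /
`graphMap` (pre-draft res-type-024, filed by res-type-042): the ideal of `R` generated by the elements of `R_[k]` killed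
by the graph parametrisation `ψ` (`x_u ↦ x_u`, `x_t ↦ x̄_t · t_F`) equals the ideal generated by `ker^{mh} φ_[k]`, for
every commutative ring `k`, all index data `σ, T, 𝔗, rel, mono` and every set `Φ` of relations in play. The preprint
[Hu2025] (arXiv:2507.21400v1) stays «under review»; nothing of it is asserted; AI proof is weaker than expert review;
nothing here is progress on resolution of singularities. Locator: chunk p0021 l.142–150; PDF p.46 L020–L024.

* §1 the block multidegree `D(e)` of an exponent (written inline as a `Finsupp.sum` — no new definition; `bdeg_add`,
  `bdeg_single_inl/inr`, `bdeg_apply`: its `G`-component is the block-`G` weight), `graphPsi_monomial`: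
  **`ψ(c x^e) = t^{D(e)} · φ(c x^e)`** for `ψ = graphMap rel mono id`, `graphPsi_eq_sum`, `coeff_graphPsi`
  (the `t^D`-coefficient of `ψ f` is `φ` of the multidegree-`D` part of `f`).
* §2 `graphPsi_eq_zero_of_mem_kerMH` (⊇), `mem_span_kerMH_of_graphPsi_eq_zero` (⊆: split `f` into its multidegree
  parts), **`Lem4_4_holds`**.
-/

noncomputable section

namespace Literature.AlgebraicGeometry.Hu2025.Statements.S04ModelV

open MvPolynomial

universe u v w x

variable {k : Type u} [CommRing k] {σ : Type v} {T : Type w} {𝔗 : Type x}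

/-! ## §1 The block multidegree `D(e) := Σ_t e(x_t) · e_{rel t}` of an exponent (written inline as a `Finsupp.sum`, no new
definition) and the graph parametrisation `ψ = graphMap rel mono id` on monomials -/

/-- `bdeg` is additive.
[cite: Hu2025, §4.1 Lem. 4.4 ‹chunk Lem. 4.3› «𝕌_[k] ⊂ ℛ_[k] is defined by the ideal ker^mh φ_[k]», chunk p0021 l.142–150, p.46 L020–L024 (unrefereed preprint arXiv:2507.21400v1 under adjudication, D-0012/D-0089 — kernel support on OUR typed carrier of row 103; nothing of the source asserted)] -/
theorem bdeg_add (rel : T → 𝔗) (e e' : σ ⊕ T →₀ ℕ) : ((e + e').sum fun i n => Sum.elim (fun _ => (0 : 𝔗 →₀ ℕ)) (fun t => Finsupp.single (rel t) n) i) = (e.sum fun i n => Sum.elim (fun _ => (0 : 𝔗 →₀ ℕ)) (fun t => Finsupp.single (rel t) n) i) + (e'.sum fun i n => Sum.elim (fun _ => (0 : 𝔗 →₀ ℕ)) (fun t => Finsupp.single (rel t) n) i) := by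
  apply Finsupp.sum_add_index'
  · intro i; cases i <;> simp
  · intro i n m; cases i <;> simp

/-- `bdeg` of a ϖ-variable exponent is `0`.
[cite: Hu2025, §4.1 Lem. 4.4 ‹chunk Lem. 4.3› «𝕌_[k] ⊂ ℛ_[k] is defined by the ideal ker^mh φ_[k]», chunk p0021 l.142–150, p.46 L020–L024 (unrefereed preprint arXiv:2507.21400v1 under adjudication, D-0012/D-0089 — kernel support on OUR typed carrier of row 103; nothing of the source asserted)] -/
theorem bdeg_single_inl (rel : T → 𝔗) (s : σ) (n : ℕ) : ((Finsupp.single (Sum.inl s : σ ⊕ T) n).sum fun i n => Sum.elim (fun _ => (0 : 𝔗 →₀ ℕ)) (fun t => Finsupp.single (rel t) n) i) = 0 := by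
  rw [Finsupp.sum_single_index] <;> rfl

/-- `bdeg` of the ϱ-variable exponent `n e_t` is `n e_{rel t}`.
[cite: Hu2025, §4.1 Lem. 4.4 ‹chunk Lem. 4.3› «𝕌_[k] ⊂ ℛ_[k] is defined by the ideal ker^mh φ_[k]», chunk p0021 l.142–150, p.46 L020–L024 (unrefereed preprint arXiv:2507.21400v1 under adjudication, D-0012/D-0089 — kernel support on OUR typed carrier of row 103; nothing of the source asserted)] -/
theorem bdeg_single_inr (rel : T → 𝔗) (t : T) (n : ℕ) :
    ((Finsupp.single (Sum.inr t : σ ⊕ T) n).sum fun i n => Sum.elim (fun _ => (0 : 𝔗 →₀ ℕ)) (fun t => Finsupp.single (rel t) n) i) = Finsupp.single (rel t) n := by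
  rw [Finsupp.sum_single_index]
  · rfl
  · simp

/-- The `G`-component of the block multidegree is the block-`G` weight.
[cite: Hu2025, §4.1 Lem. 4.4 ‹chunk Lem. 4.3› «𝕌_[k] ⊂ ℛ_[k] is defined by the ideal ker^mh φ_[k]», chunk p0021 l.142–150, p.46 L020–L024 (unrefereed preprint arXiv:2507.21400v1 under adjudication, D-0012/D-0089 — kernel support on OUR typed carrier of row 103; nothing of the source asserted)] -/
theorem bdeg_apply [DecidableEq 𝔗] (rel : T → 𝔗) (e : σ ⊕ T →₀ ℕ) (G : 𝔗) :
    (e.sum fun i n => Sum.elim (fun _ => (0 : 𝔗 →₀ ℕ)) (fun t => Finsupp.single (rel t) n) i) G = Finsupp.weight (blockWeight rel G) e := by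
  induction e using Finsupp.induction with
  | zero => simp
  | single_add i n e _ _ ih =>
    rw [bdeg_add, Finsupp.add_apply, ih, map_add, Finsupp.weight_single]
    congr 1
    cases i with
    | inl s => rw [bdeg_single_inl]; simp [blockWeight]
    | inr t =>
      rw [bdeg_single_inr, Finsupp.single_apply]
      unfold blockWeight
      simp only [Sum.elim_inr, smul_eq_mul, mul_ite, mul_one, mul_zero]

/-- `ψ` on a power of a variable: `ψ(x_i^n) = t^{D(n e_i)} · φ(x_i)^n`.
[cite: Hu2025, §4.1 Lem. 4.4 ‹chunk Lem. 4.3› «𝕌_[k] ⊂ ℛ_[k] is defined by the ideal ker^mh φ_[k]», chunk p0021 l.142–150, p.46 L020–L024 (unrefereed preprint arXiv:2507.21400v1 under adjudication, D-0012/D-0089 — kernel support on OUR typed carrier of row 103; nothing of the source asserted)] -/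
theorem graphPsi_X_pow (rel : T → 𝔗) (mono : T → (σ →₀ ℕ)) (i : σ ⊕ T) (n : ℕ) :
    graphMap rel mono (AlgHom.id k (R0 σ k)) (X i ^ n) =
      monomial (((Finsupp.single i n).sum fun i n => Sum.elim (fun _ => (0 : 𝔗 →₀ ℕ)) (fun t => Finsupp.single (rel t) n) i)) (varphi (k := k) mono (X i) ^ n) := by
  unfold graphMap varphi
  rw [map_pow, aeval_X, aeval_X]
  cases i with
  | inl s =>
    rw [bdeg_single_inl]
    simp only [Sum.elim_inl, AlgHom.coe_id, id_eq]
    rw [← map_pow, ← C_apply]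
  | inr t =>
    rw [bdeg_single_inr]
    simp only [Sum.elim_inr, AlgHom.coe_id, id_eq]
    rw [mul_pow, ← map_pow, X_pow_eq_monomial, C_mul_monomial, mul_one]

/-- **`ψ` on a monomial:** `ψ(c x^e) = t^{D(e)} · φ(c x^e)` — the graph parametrisation records the block multidegree
in the `t`-variables and the `φ`-image in the coefficient.
[cite: Hu2025, §4.1 Lem. 4.4 ‹chunk Lem. 4.3› «𝕌_[k] ⊂ ℛ_[k] is defined by the ideal ker^mh φ_[k]», chunk p0021 l.142–150, p.46 L020–L024 (unrefereed preprint arXiv:2507.21400v1 under adjudication, D-0012/D-0089 — kernel support on OUR typed carrier of row 103; nothing of the source asserted)] -/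
theorem graphPsi_monomial (rel : T → 𝔗) (mono : T → (σ →₀ ℕ)) (e : σ ⊕ T →₀ ℕ) (c : k) :
    graphMap rel mono (AlgHom.id k (R0 σ k)) (monomial e c) = monomial ((e.sum fun i n => Sum.elim (fun _ => (0 : 𝔗 →₀ ℕ)) (fun t => Finsupp.single (rel t) n) i)) (varphi (k := k) mono (monomial e c)) := by
  induction e using Finsupp.induction generalizing c with
  | zero =>
    have h1 : (monomial (0 : σ ⊕ T →₀ ℕ) c : ModelRing σ T k) = algebraMap k _ c := by
      rw [algebraMap_eq, C_apply]
    rw [h1, AlgHom.commutes, AlgHom.commutes, MvPolynomial.algebraMap_apply]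
    rw [Finsupp.sum_zero_index, ← C_apply]
  | single_add i n e _ _ ih =>
    rw [monomial_single_add, map_mul, map_mul, ih, graphPsi_X_pow, monomial_mul, ← bdeg_add, map_pow]

/-- `ψ f` as a sum over the monomials of `f`.
[cite: Hu2025, §4.1 Lem. 4.4 ‹chunk Lem. 4.3› «𝕌_[k] ⊂ ℛ_[k] is defined by the ideal ker^mh φ_[k]», chunk p0021 l.142–150, p.46 L020–L024 (unrefereed preprint arXiv:2507.21400v1 under adjudication, D-0012/D-0089 — kernel support on OUR typed carrier of row 103; nothing of the source asserted)] -/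
theorem graphPsi_eq_sum (rel : T → 𝔗) (mono : T → (σ →₀ ℕ)) (f : ModelRing σ T k) :
    graphMap rel mono (AlgHom.id k (R0 σ k)) f =
      ∑ e ∈ f.support, monomial ((e.sum fun i n => Sum.elim (fun _ => (0 : 𝔗 →₀ ℕ)) (fun t => Finsupp.single (rel t) n) i)) (varphi (k := k) mono (monomial e (coeff e f))) := by
  conv_lhs => rw [f.as_sum]
  rw [map_sum]
  exact Finset.sum_congr rfl fun e _ => graphPsi_monomial rel mono e _

/-- The `t^D`-coefficient of `ψ f` is `φ` of the block-multidegree-`D` part of `f`.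
[cite: Hu2025, §4.1 Lem. 4.4 ‹chunk Lem. 4.3› «𝕌_[k] ⊂ ℛ_[k] is defined by the ideal ker^mh φ_[k]», chunk p0021 l.142–150, p.46 L020–L024 (unrefereed preprint arXiv:2507.21400v1 under adjudication, D-0012/D-0089 — kernel support on OUR typed carrier of row 103; nothing of the source asserted)] -/
theorem coeff_graphPsi [DecidableEq 𝔗] (rel : T → 𝔗) (mono : T → (σ →₀ ℕ)) (f : ModelRing σ T k) (D : 𝔗 →₀ ℕ) :
    coeff D (graphMap rel mono (AlgHom.id k (R0 σ k)) f) =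
      varphi (k := k) mono (∑ e ∈ f.support.filter (fun e => (e.sum fun i n => Sum.elim (fun _ => (0 : 𝔗 →₀ ℕ)) (fun t => Finsupp.single (rel t) n) i) = D), monomial e (coeff e f)) := by
  classical
  rw [graphPsi_eq_sum, coeff_sum, map_sum, Finset.sum_filter]
  apply Finset.sum_congr rfl
  intro e _
  rw [coeff_monomial]

/-! ## §2 Lem. 4.4 AS TYPED -/

/-- `ψ` kills `ker^{mh} φ_Φ`: a multi-homogeneous `f` has all its monomials in ONE block multidegree `D`, so
`ψ f = t^D · φ(f)`.
[cite: Hu2025, §4.1 Lem. 4.4 ‹chunk Lem. 4.3› «𝕌_[k] ⊂ ℛ_[k] is defined by the ideal ker^mh φ_[k]», chunk p0021 l.142–150, p.46 L020–L024 (unrefereed preprint arXiv:2507.21400v1 under adjudication, D-0012/D-0089 — kernel support on OUR typed carrier of row 103; nothing of the source asserted)] -/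
theorem graphPsi_eq_zero_of_mem_kerMH [DecidableEq 𝔗] (rel : T → 𝔗) (mono : T → (σ →₀ ℕ)) (Φ : Set 𝔗)
    {f : ModelRing σ T k} (hf : f ∈ kerMH (k := k) rel mono Φ) : graphMap rel mono (AlgHom.id k (R0 σ k)) f = 0 := by
  classical
  obtain ⟨_, hH, hφ⟩ := hf
  by_cases hf0 : f = 0
  · rw [hf0, map_zero]
  obtain ⟨e₀, he₀⟩ := Finset.nonempty_of_ne_empty (mt support_eq_empty.mp hf0)
  have hD : ∀ e ∈ f.support, (e.sum fun i n => Sum.elim (fun _ => (0 : 𝔗 →₀ ℕ)) (fun t => Finsupp.single (rel t) n) i) = (e₀.sum fun i n => Sum.elim (fun _ => (0 : 𝔗 →₀ ℕ)) (fun t => Finsupp.single (rel t) n) i) := by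
    intro e he
    ext G
    obtain ⟨d, hd⟩ := hH G
    rw [bdeg_apply, bdeg_apply, hd (mem_support_iff.mp he), hd (mem_support_iff.mp he₀)]
  rw [graphPsi_eq_sum]
  calc ∑ e ∈ f.support, monomial ((e.sum fun i n => Sum.elim (fun _ => (0 : 𝔗 →₀ ℕ)) (fun t => Finsupp.single (rel t) n) i)) (varphi (k := k) mono (monomial e (coeff e f)))
      = ∑ e ∈ f.support, monomial ((e₀.sum fun i n => Sum.elim (fun _ => (0 : 𝔗 →₀ ℕ)) (fun t => Finsupp.single (rel t) n) i)) (varphi (k := k) mono (monomial e (coeff e f))) :=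
        Finset.sum_congr rfl fun e he => by rw [hD e he]
    _ = monomial ((e₀.sum fun i n => Sum.elim (fun _ => (0 : 𝔗 →₀ ℕ)) (fun t => Finsupp.single (rel t) n) i)) (varphi (k := k) mono (∑ e ∈ f.support, monomial e (coeff e f))) := by
        rw [map_sum, map_sum]
    _ = 0 := by rw [← f.as_sum, hφ, map_zero]

/-- An element of `R_Φ` killed by `ψ` lies in the ideal generated by `ker^{mh} φ_Φ`: its block-multidegree parts
`f_D` are in `R_Φ`, multi-homogeneous, and `φ(f_D) = coeff_{t^D}(ψ f) = 0`.
[cite: Hu2025, §4.1 Lem. 4.4 ‹chunk Lem. 4.3› «𝕌_[k] ⊂ ℛ_[k] is defined by the ideal ker^mh φ_[k]», chunk p0021 l.142–150, p.46 L020–L024 (unrefereed preprint arXiv:2507.21400v1 under adjudication, D-0012/D-0089 — kernel support on OUR typed carrier of row 103; nothing of the source asserted)] -/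
theorem mem_span_kerMH_of_graphPsi_eq_zero [DecidableEq 𝔗] [DecidableEq σ] [DecidableEq T] (rel : T → 𝔗)
    (mono : T → (σ →₀ ℕ)) (Φ : Set 𝔗) {f : ModelRing σ T k} (hR : f ∈ RSub (k := k) rel Φ)
    (hψ : graphMap rel mono (AlgHom.id k (R0 σ k)) f = 0) : f ∈ Ideal.span (kerMH (k := k) rel mono Φ) := by
  classical
  have hsplit : f = ∑ D ∈ f.support.image (fun e => e.sum fun i n => Sum.elim (fun _ => (0 : 𝔗 →₀ ℕ)) (fun t => Finsupp.single (rel t) n) i),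
      ∑ e ∈ f.support.filter (fun e => (e.sum fun i n => Sum.elim (fun _ => (0 : 𝔗 →₀ ℕ)) (fun t => Finsupp.single (rel t) n) i) = D), monomial e (coeff e f) := by
    rw [Finset.sum_fiberwise_of_maps_to (fun e he => Finset.mem_image_of_mem _ he)]
    exact f.as_sum
  rw [hsplit]
  apply Ideal.sum_mem
  intro D _
  apply Ideal.subset_span
  refine ⟨?_, ?_, ?_⟩
  · exact Subalgebra.sum_mem _ fun e he =>
      monomial_mem_RSub_of_mem_support rel Φ hR (Finset.mem_filter.mp he).1 _
  · intro G
    refine ⟨D G, ?_⟩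
    rw [← mem_weightedHomogeneousSubmodule]
    apply Submodule.sum_mem
    intro e he
    rw [mem_weightedHomogeneousSubmodule]
    apply isWeightedHomogeneous_monomial
    rw [← bdeg_apply, (Finset.mem_filter.mp he).2]
  · rw [← coeff_graphPsi, hψ, coeff_zero]

/-- **Hu 2025, Lem. 4.4 ‹chunk Lem. 4.3› — DISCHARGED AS TYPED** («The scheme `𝕌_[k]`, as a closed subscheme of
`ℛ_[k]`, is defined by the ideal `ker^{mh} φ_[k]`. Proof. This is immediate.»): in the row-103 rendering (the ideal of
the closure of the graph of `Θ_[k]` = the ideal of `R` generated by the elements of `R_[k]` killed by the graph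
parametrisation `ψ`), `modelUIdeal rel mono Φ = Ideal.span (ker^{mh} φ_Φ)` for every commutative ring `k`, all index
data and every `Φ`. Kernel fact about OUR rendering `S04ModelV.Lem4_4`; the preprint stays under review.
[cite: Hu2025, §4.1 Lem. 4.4 ‹chunk Lem. 4.3› «𝕌_[k] ⊂ ℛ_[k] is defined by the ideal ker^mh φ_[k]», chunk p0021 l.142–150, p.46 L020–L024 (unrefereed preprint arXiv:2507.21400v1 under adjudication, D-0012/D-0089 — kernel support on OUR typed carrier of row 103; nothing of the source asserted)] -/
theorem Lem4_4_holds : ∀ {k : Type u} [CommRing k] {σ : Type v} {T : Type w} {𝔗 : Type x} [DecidableEq 𝔗] [DecidableEq σ] [DecidableEq T]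
    (rel : T → 𝔗) (mono : T → (σ →₀ ℕ)) (Φ : Set 𝔗), Lem4_4 (k := k) rel mono Φ := by
  intro k _ σ T 𝔗 _ _ _ rel mono Φ
  unfold Lem4_4 modelUIdeal
  apply le_antisymm
  · rw [Ideal.span_le]
    rintro f ⟨hψ, hR⟩
    exact mem_span_kerMH_of_graphPsi_eq_zero rel mono Φ hR hψ
  · apply Ideal.span_mono
    intro f hf
    exact ⟨graphPsi_eq_zero_of_mem_kerMH rel mono Φ hf, hf.1⟩

end Literature.AlgebraicGeometry.Hu2025.Statements.S04ModelV

end
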